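import Summits.QuantumFields.BalabanUV.T4Continuum.Support.VariationalColourTwoRunsTaxiEnd
import Literature.MathematicalPhysics.QuantumFieldTheory.Balaban1983to89.T4EtaRateMin

/-!
# T⁴ programme, spine node NE2 (U1a), lane P2 — SUPPLIER ITEM «V-COL-NE3»: THE COLOUR TWO-RUNS END CONSUMES NODE NE3's CURRENCY BY NAME — the DAG edge for road
# P2's colour 0-form sector: the two-run class ON THE BOND FIELDS displayed by `towerLimitRate_colourTwoRunsTaxi` IS node U1b's `T4EtaRateMin.LocalRate` for the
# `Readings` of the runs' one-step bond operators (scaled matrix entries at every level), entries ⟹ operator norm by Parseval bookkeeping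
# (in the manner of row B6 `NE2FromNE3` p206441 and leaf-09-g4's U(1) `VariationalCovariantTwoRuns(NE3)`; model level; cell `pub-balaban`)

NE2 formalisation swarm `b2b-balaban-t4-ne2-formalise-*`, leaf prover 02 (gen 6); register P2-sup, item «V-COL-NE3» (INTENT CLAIMS.log l.18919).  Composition BY NAME of
«V-COL-TWO-RUNS» file 4 `VariationalColourTwoRunsTaxiEnd.towerLimitRate_colourTwoRunsTaxi` (p229777) with node U1b's `T4EtaRateMin.{Readings, LocalRate}` (NO Prop mirror).
 * §1 **`opNorm_le_sum_norm_inner`**: for `T : E →L[ℂ] E` on a finite-dimensional Hilbert space with an orthonormal basis `b : OrthonormalBasis κ ℂ E`,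
   `‖T‖ ≤ Σ_{i′} Σ_i ‖⟪b i, T (b i′)⟫‖` (Parseval: `v = Σ ⟪b i′, v⟫ b i′`, `T (b i′) = Σ ⟪b i, T b i′⟫ b i`).
 * §2 the «sites» `CSite` (level `j`, one-step bond `(y, μ)` of the level-`j` fine torus, entry `(i, i′)`, re∕im), the SCALED entry reading
   `entryOf b 𝒯 r s = L^{j+1}·⟪b i, (𝒯 r j y μ) (b i′)⟫` of the `r`-step run of a RUN FAMILY `𝒯 : ℕ → (j : ℕ) → Tor (fine L (fine (L^j) M)) → Fin d → (E →L[ℂ] E)`, and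
   **`colReadings b 𝒟 : Readings (ℕ → …) (CSite L M κ)`** (scalar reading and volume unused, as `bgReadings`) — every level is read.
 * §3 **`entry_sub_le_of_localRate`** ∕ **`norm_sub_le_of_localRate`** (and the converse `localRate_of_norm_sub` — the adapter is faithful): `LocalRate (colReadings b 𝒟) C θ → 𝒯 ∈ 𝒟 → ‖𝒯 (k+1) j y μ − 𝒯 k j y μ‖ ≤ (card κ)²·(2Cθ^k)∕L^{j+1}`
   — R4's two-run class on the bond fields with `σ k j := (card κ)²·(2Cθ^k)∕L^{j+1}`, whence `L^k·(L·σ k k) = 2(card κ)²C·θ^k` and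
   `Σ_{j<k} d(L−1)σ k j ≤ 2d(card κ)²C·θ^k` (`sum_geom_le_one`).
 * §4 **`towerLimitRate_colourTwoRunsTaxi_of_localRate`** = R4's END with `hσ`∕`hρc`∕`hτc` DISCHARGED from `LocalRate (colReadings ob 𝒟) C θ` + `𝒯 ∈ 𝒟`: for a run family
   in the class `𝒟` whose readings satisfy NE3's `LocalRate` with `0 ≤ C`, `0 ≤ θ < 1`, each run a COHERENT tower of UNITARY one-step bond operators in the plaquette class, the
   two numeric lines, `1 ≤ d`, `2 ≤ L`, `1 < M_μ`, `0 < a₀`: the run-diagonal colour effective operators converge at rate `max(L⁻¹, θ)`, `c_ρ = 2(card κ)²C`, `c_τ = d·2(card κ)²C`.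
WHAT IS NOT HERE (stated, not hidden; the c7-type caveat verbatim): the IDENTIFICATION of `colReadings ob 𝒟` with the NE3 lineage's readings object for Bałaban's minimisers
`U_k(V)` is NOT asserted (a dictionary: our runs are towers of one-step bond OPERATORS, NE3's intended readings are gauge-invariant ∕ gauge-fixed local functions of `U_k(V)`);
`LocalRate` itself (node NE3, OPEN, DISPLAYED); anything about Bałaban's `U(Γ)` (no B0, c5).

HONEST FRAMING (T4-DAG p. 1).  Pure bookkeeping (entries vs operator norm, re∕im parts, the scaling `L^{j+1}`) at MODEL level; nothing printed is a hypothesis; data defs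
`entryOf` ∕ `colReadings` + the index structure `CSite`, no `def … : Prop`, no `sorry`; axioms standard.  NE3 OPEN; NE2 NOT proved on either road; spine PROVED 0∕9; rung
(B)+1 finite T⁴ — NOT infinite volume, NOT mass gap, NOT Clay.  HONEST DEPENDENCY (cell, verbatim): continuum YM on T⁴ ⇐ BetaPertH ∧ nine spine estimates (0/9 proved);
BetaPertH ⇐ (D1) ∧ (D4) ∧ CAP+tail; G-an2-4 gates asym, D1 and NE2/3/4.
-/

noncomputable section

namespace Summit.QuantumFields.BalabanUV.T4Continuum.VariationalColourTwoRunsNE3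

open Finset
open scoped Matrix InnerProductSpace
open Literature.MathematicalPhysics.QuantumFieldTheory.Balaban1983to89
open Literature.MathematicalPhysics.QuantumFieldTheory.Balaban1983to89.B5Prop11Plancherel (Tor fine unitVec)
open Literature.MathematicalPhysics.QuantumFieldTheory.Balaban1983to89.T4EtaRateMin (Readings LocalRate)
open Summit.QuantumFields.BalabanUV.T4Continuum.CovariantAveragingTower (TowerLimitRate)
open Summit.QuantumFields.BalabanUV.T4Continuum.VariationalColourTower (Rtrv)
open Summit.QuantumFields.BalabanUV.T4Continuum.VariationalColourTaxiTransport
open Summit.QuantumFields.BalabanUV.T4Continuum.VariationalEffectiveHilbertPairs (effC)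
open Summit.QuantumFields.BalabanUV.T4Continuum.VariationalVectorEndOfLeaves (eV ePV)
open Summit.QuantumFields.BalabanUV.T4Continuum.VariationalColourTwoRunsTaxiEnd (towerLimitRate_colourTwoRunsTaxi)

variable {d : ℕ} {E : Type*} [NormedAddCommGroup E] [InnerProductSpace ℂ E]
variable {κ : Type*} [Fintype κ]

/-! ## §1 Entries bound the operator norm -/

/-- **entries ⟹ operator norm** (Parseval bookkeeping): `‖T‖ ≤ Σ_{i′} Σ_i ‖⟪b i, T (b i′)⟫‖` for an orthonormal basis `b`. [folklore] -/
theorem opNorm_le_sum_norm_inner (b : OrthonormalBasis κ ℂ E) (T : E →L[ℂ] E) : ‖T‖ ≤ ∑ i', ∑ i, ‖⟪b i, T (b i')⟫_ℂ‖ := by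
  have hcol : ∀ i', ‖T (b i')‖ ≤ ∑ i, ‖⟪b i, T (b i')⟫_ℂ‖ := fun i' => by
    calc ‖T (b i')‖ = ‖∑ i, ⟪b i, T (b i')⟫_ℂ • b i‖ := by rw [b.sum_repr' (T (b i'))]
      _ ≤ ∑ i, ‖⟪b i, T (b i')⟫_ℂ • b i‖ := norm_sum_le _ _
      _ = ∑ i, ‖⟪b i, T (b i')⟫_ℂ‖ := by
          refine Finset.sum_congr rfl fun i _ => ?_
          rw [norm_smul, b.norm_eq_one, mul_one]
  have h0 : 0 ≤ ∑ i', ∑ i, ‖⟪b i, T (b i')⟫_ℂ‖ := Finset.sum_nonneg fun _ _ => Finset.sum_nonneg fun _ _ => norm_nonneg _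
  refine ContinuousLinearMap.opNorm_le_bound _ h0 fun v => ?_
  calc ‖T v‖ = ‖∑ i', ⟪b i', v⟫_ℂ • T (b i')‖ := by
        conv_lhs => rw [← b.sum_repr' v]
        rw [map_sum]; simp_rw [map_smul]
    _ ≤ ∑ i', ‖⟪b i', v⟫_ℂ • T (b i')‖ := norm_sum_le _ _
    _ ≤ ∑ i', ‖v‖ * ∑ i, ‖⟪b i, T (b i')⟫_ℂ‖ := Finset.sum_le_sum fun i' _ => by
        rw [norm_smul]
        refine mul_le_mul ?_ (hcol i') (norm_nonneg _) (norm_nonneg _)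
        calc ‖⟪b i', v⟫_ℂ‖ ≤ ‖b i'‖ * ‖v‖ := norm_inner_le_norm _ _
          _ = ‖v‖ := by rw [b.norm_eq_one, one_mul]
    _ = (∑ i', ∑ i, ‖⟪b i, T (b i')⟫_ℂ‖) * ‖v‖ := by rw [← Finset.mul_sum, mul_comm]

/-! ## §2 The readings of a class of run families of one-step bond-operator towers -/

/-- a «site» of the readings: level `j`, a one-step bond `(pt, dir)` of the level-`j` fine torus, a matrix entry `(row, col)`, real ∕ imaginary part. [folklore] -/
structure CSite (L : ℕ) (M : Fin d → ℕ) (κ : Type*) where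
  /-- level -/
  lvl : ℕ
  /-- bond base point on the one-step-fine torus over level `lvl` -/
  pt : Tor (fine L (fine (L ^ lvl) M))
  /-- bond direction -/
  dir : Fin d
  /-- matrix row (orthonormal basis index) -/
  row : κ
  /-- matrix column -/
  col : κ
  /-- real (`true`) or imaginary (`false`) part -/
  re : Bool

variable (L : ℕ) (M : Fin d → ℕ)

/-- the SCALED entry read from the `r`-step run: `L^{j+1}·⟪b i, (𝒯 r j y μ) (b i′)⟫`. [folklore] -/
def entryOf (b : OrthonormalBasis κ ℂ E) (𝒯 : ℕ → (j : ℕ) → Tor (fine L (fine (L ^ j) M)) → Fin d → (E →L[ℂ] E)) (r : ℕ) (s : CSite L M κ) : ℂ :=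
  ((L : ℂ) ^ (s.lvl + 1)) * ⟪b s.row, (𝒯 r s.lvl s.pt s.dir) (b s.col)⟫_ℂ

/-- **THE READINGS OF A CLASS `𝒟` OF RUN FAMILIES** (node U1b's `T4EtaRateMin.Readings`; scalar reading and volume unused): the local reading of the `r`-step run at the site
`s` is the real ∕ imaginary part of the scaled entry `entryOf b 𝒯 r s`. [folklore] -/
def colReadings (b : OrthonormalBasis κ ℂ E) (𝒟 : Set (ℕ → (j : ℕ) → Tor (fine L (fine (L ^ j) M)) → Fin d → (E →L[ℂ] E))) :
    Readings (ℕ → (j : ℕ) → Tor (fine L (fine (L ^ j) M)) → Fin d → (E →L[ℂ] E)) (CSite L M κ) where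
  dom := 𝒟
  act := fun _ _ => 0
  loc := fun r 𝒯 s => if s.re then (entryOf L M b 𝒯 r s).re else (entryOf L M b 𝒯 r s).im
  vol := 0
  vol_nonneg := le_rfl

/-! ## §3 `LocalRate` ⟹ the two-run class on the bond fields -/

section Edge

variable [NeZero L] {b : OrthonormalBasis κ ℂ E} {𝒟 : Set (ℕ → (j : ℕ) → Tor (fine L (fine (L ^ j) M)) → Fin d → (E →L[ℂ] E))} {C θ : ℝ}

/-- **NE3's currency ⟹ entrywise closeness of consecutive runs at every level**: `‖⟪b i, (𝒯 (k+1) j y μ − 𝒯 k j y μ) (b i′)⟫‖ ≤ 2Cθ^k ∕ L^{j+1}`. [folklore] -/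
theorem entry_sub_le_of_localRate (h : LocalRate (colReadings L M b 𝒟) C θ)
    {𝒯 : ℕ → (j : ℕ) → Tor (fine L (fine (L ^ j) M)) → Fin d → (E →L[ℂ] E)} (h𝒯 : 𝒯 ∈ 𝒟) (k j : ℕ) (y : Tor (fine L (fine (L ^ j) M))) (μ : Fin d)
    (i i' : κ) : ‖⟪b i, (𝒯 (k + 1) j y μ - 𝒯 k j y μ) (b i')⟫_ℂ‖ ≤ 2 * (C * θ ^ k) / (L : ℝ) ^ (j + 1) := by
  have hL0 : (0 : ℝ) < (L : ℝ) ^ (j + 1) := by have := NeZero.ne L; positivity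
  have key : ∀ re : Bool, |(if re then (entryOf L M b 𝒯 (k + 1) ⟨j, y, μ, i, i', re⟩).re else (entryOf L M b 𝒯 (k + 1) ⟨j, y, μ, i, i', re⟩).im)
      - (if re then (entryOf L M b 𝒯 k ⟨j, y, μ, i, i', re⟩).re else (entryOf L M b 𝒯 k ⟨j, y, μ, i, i', re⟩).im)| ≤ C * θ ^ k :=
    fun re => h k 𝒯 h𝒯 ⟨j, y, μ, i, i', re⟩
  have hre := key true
  have him := key false
  simp only [if_true, Bool.false_eq_true, if_false] at hre him
  rw [← Complex.sub_re] at hre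
  rw [← Complex.sub_im] at him
  -- the scaled difference
  have hdiff : entryOf L M b 𝒯 (k + 1) ⟨j, y, μ, i, i', true⟩ - entryOf L M b 𝒯 k ⟨j, y, μ, i, i', true⟩
      = ((L : ℂ) ^ (j + 1)) * ⟪b i, (𝒯 (k + 1) j y μ - 𝒯 k j y μ) (b i')⟫_ℂ := by
    simp only [entryOf, FunLike.coe_sub, Pi.sub_apply, inner_sub_right, mul_sub]
  have hdiff' : entryOf L M b 𝒯 (k + 1) ⟨j, y, μ, i, i', false⟩ - entryOf L M b 𝒯 k ⟨j, y, μ, i, i', false⟩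
      = ((L : ℂ) ^ (j + 1)) * ⟪b i, (𝒯 (k + 1) j y μ - 𝒯 k j y μ) (b i')⟫_ℂ := by
    simp only [entryOf, FunLike.coe_sub, Pi.sub_apply, inner_sub_right, mul_sub]
  rw [hdiff] at hre
  rw [hdiff'] at him
  have hnorm : ‖((L : ℂ) ^ (j + 1)) * ⟪b i, (𝒯 (k + 1) j y μ - 𝒯 k j y μ) (b i')⟫_ℂ‖ ≤ 2 * (C * θ ^ k) :=
    calc _ ≤ |(((L : ℂ) ^ (j + 1)) * ⟪b i, (𝒯 (k + 1) j y μ - 𝒯 k j y μ) (b i')⟫_ℂ).re|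
          + |(((L : ℂ) ^ (j + 1)) * ⟪b i, (𝒯 (k + 1) j y μ - 𝒯 k j y μ) (b i')⟫_ℂ).im| := Complex.norm_le_abs_re_add_abs_im _
      _ ≤ C * θ ^ k + C * θ ^ k := add_le_add hre him
      _ = 2 * (C * θ ^ k) := by ring
  rw [norm_mul, norm_pow, Complex.norm_natCast] at hnorm
  rw [le_div_iff₀ hL0, mul_comm]
  exact hnorm

/-- **NE3's currency ⟹ the two-run class on the bond fields, in operator norm**: `‖𝒯 (k+1) j y μ − 𝒯 k j y μ‖ ≤ (card κ)²·(2Cθ^k)∕L^{j+1}`. [folklore] -/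
theorem norm_sub_le_of_localRate (h : LocalRate (colReadings L M b 𝒟) C θ)
    {𝒯 : ℕ → (j : ℕ) → Tor (fine L (fine (L ^ j) M)) → Fin d → (E →L[ℂ] E)} (h𝒯 : 𝒯 ∈ 𝒟) (k j : ℕ) (y : Tor (fine L (fine (L ^ j) M))) (μ : Fin d) :
    ‖𝒯 (k + 1) j y μ - 𝒯 k j y μ‖ ≤ ((Fintype.card κ : ℝ) ^ 2) * (2 * (C * θ ^ k) / (L : ℝ) ^ (j + 1)) := by
  refine (opNorm_le_sum_norm_inner b _).trans ?_
  calc ∑ i', ∑ i, ‖⟪b i, (𝒯 (k + 1) j y μ - 𝒯 k j y μ) (b i')⟫_ℂ‖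
      ≤ ∑ _i' : κ, ∑ _i : κ, 2 * (C * θ ^ k) / (L : ℝ) ^ (j + 1) :=
        Finset.sum_le_sum fun i' _ => Finset.sum_le_sum fun i _ => entry_sub_le_of_localRate L M h h𝒯 k j y μ i i'
    _ = ((Fintype.card κ : ℝ) ^ 2) * (2 * (C * θ ^ k) / (L : ℝ) ^ (j + 1)) := by
        rw [Finset.sum_const, Finset.card_univ, nsmul_eq_mul, Finset.sum_const, Finset.card_univ, nsmul_eq_mul]; ring

/-- **THE CONVERSE (the adapter is faithful)**: operator-norm closeness `‖𝒯 (k+1) j y μ − 𝒯 k j y μ‖ ≤ Cθ^k∕L^{j+1}` for every family of the class gives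
`LocalRate (colReadings b 𝒟) C θ`. [folklore] -/
theorem localRate_of_norm_sub
    (hβ : ∀ 𝒯 ∈ 𝒟, ∀ (k j : ℕ) (y : Tor (fine L (fine (L ^ j) M))) (μ : Fin d), ‖𝒯 (k + 1) j y μ - 𝒯 k j y μ‖ ≤ C * θ ^ k / (L : ℝ) ^ (j + 1)) :
    LocalRate (colReadings L M b 𝒟) C θ := by
  intro k 𝒯 h𝒯 s
  obtain ⟨j, y, μ, i, i', re⟩ := s
  have hL0 : (0 : ℝ) < (L : ℝ) ^ (j + 1) := by have := NeZero.ne L; positivity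
  have hdiff : ∀ re' : Bool, (if re' then (entryOf L M b 𝒯 (k + 1) ⟨j, y, μ, i, i', re'⟩).re else (entryOf L M b 𝒯 (k + 1) ⟨j, y, μ, i, i', re'⟩).im)
      - (if re' then (entryOf L M b 𝒯 k ⟨j, y, μ, i, i', re'⟩).re else (entryOf L M b 𝒯 k ⟨j, y, μ, i, i', re'⟩).im)
      = (if re' then (((L : ℂ) ^ (j + 1)) * ⟪b i, (𝒯 (k + 1) j y μ - 𝒯 k j y μ) (b i')⟫_ℂ).re
          else (((L : ℂ) ^ (j + 1)) * ⟪b i, (𝒯 (k + 1) j y μ - 𝒯 k j y μ) (b i')⟫_ℂ).im) := fun re' => by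
    cases re' <;> simp only [if_true, Bool.false_eq_true, if_false, entryOf, FunLike.coe_sub, Pi.sub_apply, inner_sub_right, mul_sub,
      Complex.sub_re, Complex.sub_im]
  have hz : ‖((L : ℂ) ^ (j + 1)) * ⟪b i, (𝒯 (k + 1) j y μ - 𝒯 k j y μ) (b i')⟫_ℂ‖ ≤ C * θ ^ k := by
    rw [norm_mul, norm_pow, Complex.norm_natCast]
    have h1 : ‖⟪b i, (𝒯 (k + 1) j y μ - 𝒯 k j y μ) (b i')⟫_ℂ‖ ≤ C * θ ^ k / (L : ℝ) ^ (j + 1) :=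
      calc ‖⟪b i, (𝒯 (k + 1) j y μ - 𝒯 k j y μ) (b i')⟫_ℂ‖ ≤ ‖b i‖ * ‖(𝒯 (k + 1) j y μ - 𝒯 k j y μ) (b i')‖ := norm_inner_le_norm _ _
        _ ≤ 1 * (‖𝒯 (k + 1) j y μ - 𝒯 k j y μ‖ * ‖b i'‖) := by
            rw [b.norm_eq_one]; exact mul_le_mul_of_nonneg_left (ContinuousLinearMap.le_opNorm _ _) zero_le_one
        _ = ‖𝒯 (k + 1) j y μ - 𝒯 k j y μ‖ := by rw [b.norm_eq_one, mul_one, one_mul]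
        _ ≤ C * θ ^ k / (L : ℝ) ^ (j + 1) := hβ 𝒯 h𝒯 k j y μ
    calc (L : ℝ) ^ (j + 1) * ‖⟪b i, (𝒯 (k + 1) j y μ - 𝒯 k j y μ) (b i')⟫_ℂ‖ ≤ (L : ℝ) ^ (j + 1) * (C * θ ^ k / (L : ℝ) ^ (j + 1)) :=
          mul_le_mul_of_nonneg_left h1 hL0.le
      _ = C * θ ^ k := by field_simp
  show |(if re then (entryOf L M b 𝒯 (k + 1) ⟨j, y, μ, i, i', re⟩).re else (entryOf L M b 𝒯 (k + 1) ⟨j, y, μ, i, i', re⟩).im)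
      - (if re then (entryOf L M b 𝒯 k ⟨j, y, μ, i, i', re⟩).re else (entryOf L M b 𝒯 k ⟨j, y, μ, i, i', re⟩).im)| ≤ C * θ ^ k
  rw [hdiff re]
  cases re
  · exact (Complex.abs_im_le_norm _).trans hz
  · exact (Complex.abs_re_le_norm _).trans hz

omit [NeZero L] in
/-- `Σ_{j<k} (L−1)∕L^{j+1} = 1 − L^{−k} ≤ 1` (`1 ≤ L`). [folklore] -/
theorem sum_geom_le_one (hL1 : (1 : ℝ) ≤ L) (k : ℕ) : ∑ j ∈ Finset.range k, ((L : ℝ) - 1) / (L : ℝ) ^ (j + 1) ≤ 1 := by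
  have hL0 : (L : ℝ) ≠ 0 := by positivity
  have hterm : ∀ j ∈ Finset.range k, ((L : ℝ) - 1) / (L : ℝ) ^ (j + 1) = ((L : ℝ)⁻¹) ^ j - ((L : ℝ)⁻¹) ^ (j + 1) := fun j _ => by
    rw [pow_succ, inv_pow, inv_pow, pow_succ]
    field_simp
  rw [Finset.sum_congr rfl hterm, Finset.sum_range_sub', pow_zero]
  have : 0 ≤ ((L : ℝ)⁻¹) ^ k := by positivity
  linarith

end Edge

/-! ## §4 The colour two-runs END at taxi data, its two-run class read from NE3's `LocalRate` -/

section End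

variable [CompleteSpace E] [FiniteDimensional ℂ E] [DecidableEq κ]
variable [NeZero L] [hM : ∀ μ, NeZero (M μ)]

/-- **THE COLOUR 0-FORM TWO-RUNS END AT TAXI DATA, NE3 BY NAME.**  A run family `𝒯` in a class `𝒟` whose `colReadings` satisfy node U1b's `LocalRate … C θ` (`0 ≤ C`, `0 ≤ θ < 1`),
each run a COHERENT tower of UNITARY one-step bond operators in the plaquette class `(L^k·L)²·b_k ≤ c`, the two numeric smallness lines, `1 ≤ d`, `2 ≤ L`, `1 < M_μ`, `0 < a₀` ⟹
`TowerLimitRate (fun _ ↦ 1) 1 (k ↦ effC (L^k) M (coarseTv (𝒯 k k)) (nestTv (𝒯 k) k) ob a₀) (C_pair + eV Λc⋆ 136 (√d·c_ρ + √Λc⋆·c_τ)) (max L⁻¹ θ)` with `c_ρ = 2(card κ)²C`,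
`c_τ = d·2(card κ)²C`.  `LocalRate` is DISPLAYED (NE3 OPEN); the identification of `colReadings` with the NE3 lineage's readings of Bałaban's minimisers is NOT asserted. [folklore] -/
theorem towerLimitRate_colourTwoRunsTaxi_of_localRate (hd : 1 ≤ d) (hL : 2 ≤ L) (hM2 : ∀ μ, 1 < M μ)
    {𝒟 : Set (ℕ → (j : ℕ) → Tor (fine L (fine (L ^ j) M)) → Fin d → (E →L[ℂ] E))}
    {𝒯 : ℕ → (j : ℕ) → Tor (fine L (fine (L ^ j) M)) → Fin d → (E →L[ℂ] E)} (h𝒯 : 𝒯 ∈ 𝒟)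
    (hU : ∀ r k x μ, 𝒯 r k x μ ∈ unitary (E →L[ℂ] E)) {b : ℕ → ℝ} (hb0 : ∀ k, 0 ≤ b k)
    (hb : ∀ r k x κ' ι,
      ‖𝒯 r k x κ' * 𝒯 r k (x + unitVec (fine L (fine (L ^ k) M)) κ') ι - 𝒯 r k x ι * 𝒯 r k (x + unitVec (fine L (fine (L ^ k) M)) ι) κ'‖ ≤ b k)
    (hcoh : ∀ r k, coarseTv L (fine (L ^ (k + 1)) M) (𝒯 r (k + 1)) = Rtrv (L ^ k) L M (𝒯 r k))
    {c : ℝ} (hclass : ∀ k, ((((L ^ k : ℕ)) : ℝ) * L) ^ 2 * b k ≤ c)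
    (hc₁ : 64 * (d : ℝ) * (((d - 1 : ℕ) : ℝ) * c) ^ 2 ≤ 1 / 2)
    (hc₂ : 2 * (d : ℝ) * (((d - 1 : ℕ) : ℝ) * c) ^ 2 + 4 * (((((d - 1 : ℕ) : ℝ) + (d : ℝ) * d) * c)) ^ 2 ≤ 1 / 2)
    -- node NE3's currency, BY NAME
    (ob : OrthonormalBasis κ ℂ E) {C θ : ℝ} (hC : 0 ≤ C) (hθ0 : 0 ≤ θ) (hθ1 : θ < 1) (hNE3 : LocalRate (colReadings L M ob 𝒟) C θ)
    {a₀ : ℝ} (ha₀ : 0 < a₀) :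
    let cw : ℝ := (4 + ((d - 1 : ℕ) : ℝ) * c) / (1 - (((d - 1 : ℕ) : ℝ) + (d : ℝ) * d) * c)
    let cm : ℝ := ((d - 1 : ℕ) : ℝ) * c
    let c₁ : ℝ := 2 * ((d - 1 : ℕ) : ℝ) * c
    let Λcs : ℝ := 2 * d * (36 : ℝ) ^ d * ((1 + cw) ^ 2 + 9)
    let CRs : ℝ := 2 * Λcs + 2 * d * c + (d : ℝ) ^ 2 * c ^ 2 * 136
    let cε : ℝ := ((d : ℝ) / 4 + 1 / 2) * L
    let cδ' : ℝ := Real.sqrt (2 * d * (1 + (d : ℝ) ^ 2)) * ((L : ℝ) * c₁)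
    let Λs : ℝ := Λcs + (cε * CRs + 2 * cδ' * Real.sqrt ((1 + cε * CRs) * 136) + cδ' ^ 2 * 136) * (Λcs + 1)
    let cρ : ℝ := 2 * ((Fintype.card κ : ℝ) ^ 2) * C
    TowerLimitRate (ι := fun _ => Tor M × κ) (fun _ => (1 : Matrix (Tor M × κ) (Tor M × κ) ℂ)) 1
      (fun k => effC (L ^ k) M (coarseTv L (fine (L ^ k) M) (𝒯 k k)) (nestTv L M (𝒯 k) k) ob a₀)
      (eV Λs 136 (Real.sqrt d * cm) + ePV Λs 136 CRs cε cδ' + eV Λcs 136 (Real.sqrt d * cρ + Real.sqrt Λcs * ((d : ℝ) * cρ))) (max ((L : ℝ)⁻¹) θ) := by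
  intro cw cm c₁ Λcs CRs cε cδ' Λs cρ
  have hL1 : (1 : ℝ) ≤ L := by exact_mod_cast (show 1 ≤ L by omega)
  have hκ : (0 : ℝ) ≤ (Fintype.card κ : ℝ) ^ 2 := by positivity
  -- the two-run class on the bond fields from `LocalRate`
  have hσ : ∀ k j x μ, ‖𝒯 (k + 1) j x μ - 𝒯 k j x μ‖ ≤ ((Fintype.card κ : ℝ) ^ 2) * (2 * (C * θ ^ k) / (L : ℝ) ^ (j + 1)) :=
    fun k j x μ => norm_sub_le_of_localRate L M hNE3 h𝒯 k j x μ
  have hρc : ∀ k, (((L ^ k : ℕ)) : ℝ) * ((L : ℝ) * (((Fintype.card κ : ℝ) ^ 2) * (2 * (C * θ ^ k) / (L : ℝ) ^ (k + 1)))) ≤ cρ * θ ^ k := fun k => by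
    have hL0 : (0 : ℝ) < (L : ℝ) ^ (k + 1) := by positivity
    have e : (((L ^ k : ℕ)) : ℝ) * ((L : ℝ) * (((Fintype.card κ : ℝ) ^ 2) * (2 * (C * θ ^ k) / (L : ℝ) ^ (k + 1)))) = cρ * θ ^ k := by
      push_cast
      rw [pow_succ]
      field_simp
      ring
    rw [e]
  have hτc : ∀ k, ∑ j ∈ Finset.range k, (d : ℝ) * (((L - 1 : ℕ) : ℝ) * (((Fintype.card κ : ℝ) ^ 2) * (2 * (C * θ ^ k) / (L : ℝ) ^ (j + 1))))
      ≤ (d : ℝ) * cρ * θ ^ k := fun k => by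
    have hL1' : ((L - 1 : ℕ) : ℝ) = (L : ℝ) - 1 := by rw [Nat.cast_sub (by omega), Nat.cast_one]
    have hθk : 0 ≤ C * θ ^ k := by positivity
    calc ∑ j ∈ Finset.range k, (d : ℝ) * (((L - 1 : ℕ) : ℝ) * (((Fintype.card κ : ℝ) ^ 2) * (2 * (C * θ ^ k) / (L : ℝ) ^ (j + 1))))
        = (d : ℝ) * cρ * θ ^ k * ∑ j ∈ Finset.range k, ((L : ℝ) - 1) / (L : ℝ) ^ (j + 1) := by
          rw [Finset.mul_sum]; refine Finset.sum_congr rfl fun j _ => ?_; rw [hL1']; ring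
      _ ≤ (d : ℝ) * cρ * θ ^ k * 1 := mul_le_mul_of_nonneg_left (sum_geom_le_one L hL1 k) (by positivity)
      _ = (d : ℝ) * cρ * θ ^ k := mul_one _
  exact towerLimitRate_colourTwoRunsTaxi L M hd hL hM2 hU hb0 hb hcoh hclass hc₁ hc₂
    (fun k j => ((Fintype.card κ : ℝ) ^ 2) * (2 * (C * θ ^ k) / (L : ℝ) ^ (j + 1))) (fun k j => by positivity) hσ hθ0 hθ1 hρc hτc ob ha₀

end End

end Summit.QuantumFields.BalabanUV.T4Continuum.VariationalColourTwoRunsNE3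

end
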